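import Literature.Probability.RandomPlanarGeometry.TangentAtSLE6
import Literature.Probability.RandomPlanarGeometry.LatticeSimilarityCovariance
import HarnessLib

/-!
# Tangent vectors of chordal curve families: non-vacuity and the linearised covariance theorems

Companion of `TangentAtSLE6.lean` (definition item `defn-TangentAtSLE6`, route CardyAnchoredRigidity
of `CriticalPhenomena/CardyFormulaZ2`), theorems only:

* `isMirrorCovariant_iff` — the measure-level mirror clause is the inline `hconj` of
  `IsometryCovariance.lean`; it is also clause (b) of `IsLatticeSimilarityCovariant` (use the
  projection `h.2` of `h : P.IsLatticeSimilarityCovariant` directly; no separate lemma);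
* MASS CONSERVATION: `velocity_apply_const_eq_zero`, `apply_one_eq_zero_of_mem_tangentCone`
  (curves of probability laws have `Ṗ_D 1 = 0`);
* NON-VACUITY: the mass-scaling curve `ε ↦ (1 + ε) · P₀` is a deformation curve in the class of
  all families, `C¹` along every test class, with velocity `D ↦ 𝒯.indicator (f ↦ ∫ f d(P₀ D))`
  (`indicator_coord_mem_tangentCone_univ`: tangent cones are not reduced to `{0}`); the cone is
  symmetric (`neg_mem_tangentCone`); `zero_mem_tangentAtSLE6_iff`: `TangentAtSLE6 𝒞` is inhabited
  iff `𝒞` contains a family of SLE₆ laws (the clause to pair with `H1VanishesAtSLE6 𝒞`), and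
  `zero_mem_tangentAtSLE6`: given the named fact `exists_isSLECurve` this holds for every class
  containing the SLE₆ families;
* THE FIRST LINEARISED AXIOM AS A THEOREM: `velocity_isCovariantUnder` — if the families `c ε` are
  covariant under a plane homeomorphism `φ` for small `|ε|`, the velocity of `c` satisfies
  `Deformation.IsCovariantUnder` (both sides are derivatives of coordinates that agree near `0`,
  by change of variables along the measurable self-equivalence of curve space induced by `φ`,
  `measurableEmbedding_curveClassMap`, no measurability of the observable needed); whence
  `velocity_isMirrorCovariant`, `velocity_isSimilarityCovariant` (`similarity_symm`: the inverse
  of `z ↦ c z + w` is a similarity); likewise `velocity_isChordal` (linearised chordality: mass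
  conservation + dependence on the chordal curves only, by `integral_congr_ae`); together
  `linearised_of_mem_tangentAtSLE6`: every `v ∈ TangentAtSLE6 mirrorLocalMarkovClass` is chordal,
  similarity covariant and mirror covariant to first order.

Sources: W. Werner, *Lectures on two-dimensional critical percolation* (2007) §3.2 (1), (3) (the
covariances being differentiated). Mathlib: `MeasurableEquiv.measurableEmbedding`,
`MeasurableEmbedding.integral_map`, `Filter.EventuallyEq.deriv_eq`, `integral_smul_measure`,
`HasDerivAt.deriv`. Tree: `TangentAtSLE6` (all notions), `CurveClass.map_homeomorph_trans`,
`measurable_curveClassMap_conj` (LatticeSimilarityCovariance), `measurable_curveClassMap_similarity`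
(ChordalCurveFamily), `exists_isSLECurve`, `IsSLECurve.isSLELaw_map` (SLE).
-/

noncomputable section

open Set MeasureTheory Topology Filter
open scoped NNReal ENNReal

namespace Literature.Probability.RandomPlanarGeometry

namespace ChordalFamily

/-! ### Mirror covariance: the clause in the hypothesis shape of `IsometryCovariance.lean`

(Mirror covariance is literally clause (b) of `IsLatticeSimilarityCovariant`: from
`h : P.IsLatticeSimilarityCovariant` take `h.2`.) -/

/-- A family covariant under every `z ↦ c z̄ + w`-generating reflection datum in the hypothesis
shape `hconj` of `IsometryCovariance.lean` is mirror covariant (the two are the same clause).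
[folklore] -/
theorem isMirrorCovariant_iff (P : ChordalFamily) :
    P.IsMirrorCovariant ↔ ∀ D : DobrushinDomain, P (D.map Complex.conjLIE.toHomeomorph) =
      (P D).map (CurveClass.map (Complex.conjLIE.toHomeomorph : C(ℂ, ℂ))) :=
  Iff.rfl

/-! ### Symmetry of the cone -/

/-- The tangent cone is symmetric under `v ↦ -v` (run the curve backwards, `ε ↦ c (-ε)`).
[folklore] -/
theorem neg_mem_tangentCone {𝒞 : Set ChordalFamily} {𝒯 : Set (CurveClass ℂ → ℝ)}
    {P₀ : ChordalFamily} {v : Deformation} (hv : v ∈ tangentCone 𝒞 P₀ 𝒯) :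
    -v ∈ tangentCone 𝒞 P₀ 𝒯 := by
  simpa using smul_mem_tangentCone hv (-1)

/-! ### Mass conservation -/

/-- **Mass conservation.** Along a curve of families of probability laws the coordinate of the
constant observable `1` is constantly `1`, so its velocity vanishes: `Ṗ_D 1 = 0`. [folklore] -/
theorem velocity_apply_const_eq_zero {𝒯 : Set (CurveClass ℂ → ℝ)} {c : ℝ → ChordalFamily}
    (D : DobrushinDomain)
    (h : ∀ᶠ ε in 𝓝 (0 : ℝ), IsProbabilityMeasure (c ε D)) (a : ℝ) :
    velocity 𝒯 c D (fun _ => a) = 0 := by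
  by_cases hf : (fun _ : CurveClass ℂ => a) ∈ 𝒯
  · rw [velocity_apply_of_mem _ D hf]
    have hev : (fun ε => coord (c ε) D fun _ => a) =ᶠ[𝓝 0] fun _ => a := by
      filter_upwards [h] with ε hε
      simp [coord]
    rw [hev.deriv_eq]
    exact deriv_const 0 a
  · exact velocity_apply_of_not_mem _ D hf

/-- Tangent vectors of a class of families of probability laws (e.g. any class of chordal
families) conserve mass: `Ṗ_D 1 = 0`, the first clause of `Deformation.IsChordal`. [folklore] -/
theorem apply_one_eq_zero_of_mem_tangentCone {𝒞 : Set ChordalFamily} {𝒯 : Set (CurveClass ℂ → ℝ)}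
    {P₀ : ChordalFamily} (h𝒞 : ∀ P ∈ 𝒞, ∀ D, IsProbabilityMeasure (P D)) {v : Deformation}
    (hv : v ∈ tangentCone 𝒞 P₀ 𝒯) (D : DobrushinDomain) : v D (fun _ => 1) = 0 := by
  obtain ⟨c, hc, rfl⟩ := hv
  exact velocity_apply_const_eq_zero D (hc.eventually_mem.mono fun ε hε => h𝒞 _ hε D) 1

/-! ### Velocities of chordal curves are chordal to first order -/

/-- **Linearised chordality as a theorem.** Along a curve of chordal families the velocity
conserves mass and sees test observables only through their values on the chordal curves of `D`
(two observables agreeing there have a.e.-equal integrands, hence equal coordinates near `0`).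
[folklore] -/
theorem velocity_isChordal {𝒯 : Set (CurveClass ℂ → ℝ)} {c : ℝ → ChordalFamily}
    (h : ∀ᶠ ε in 𝓝 (0 : ℝ), (c ε).IsChordal) : (velocity 𝒯 c).IsChordal 𝒯 := by
  intro D
  refine ⟨velocity_apply_const_eq_zero D (h.mono fun ε hε => (hε D).1) 1,
    fun f hf g hg hfg => ?_⟩
  rw [velocity_apply_of_mem c D hf, velocity_apply_of_mem c D hg]
  refine Filter.EventuallyEq.deriv_eq ?_
  filter_upwards [h] with ε hε
  simp only [coord]
  refine integral_congr_ae ?_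
  filter_upwards [(hε D).2] with γ hγ
  exact hfg γ hγ.1 hγ.2.1 hγ.2.2

/-- Every tangent vector of a class of chordal families is chordal to first order. [folklore] -/
theorem isChordal_of_mem_tangentCone {𝒞 : Set ChordalFamily} {𝒯 : Set (CurveClass ℂ → ℝ)}
    {P₀ : ChordalFamily} (h𝒞 : ∀ P ∈ 𝒞, P.IsChordal) {v : Deformation}
    (hv : v ∈ tangentCone 𝒞 P₀ 𝒯) : v.IsChordal 𝒯 := by
  obtain ⟨c, hc, rfl⟩ := hv
  exact velocity_isChordal (hc.eventually_mem.mono fun ε hε => h𝒞 _ hε)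

/-! ### A non-trivial deformation curve: scaling the mass -/

section MassScaling

variable (𝒯 : Set (CurveClass ℂ → ℝ)) (P₀ : ChordalFamily)

/-- The **mass-scaling curve** `ε ↦ (1 + ε) · P₀` (total mass deformed, shape fixed): the
simplest deformation curve with a non-zero velocity, recorded to show that the tangent-cone
machinery is non-degenerate (inside the class of ALL families; it leaves every class of
probability laws). [folklore] -/
theorem coord_massScaling_eventuallyEq (D : DobrushinDomain) (f : CurveClass ℂ → ℝ) :
    (fun ε : ℝ => coord (fun D => ENNReal.ofReal (1 + ε) • P₀ D) D f) =ᶠ[𝓝 0]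
      fun ε => (1 + ε) * coord P₀ D f := by
  have h : ∀ᶠ ε : ℝ in 𝓝 0, 0 ≤ 1 + ε := by
    have : Tendsto (fun ε : ℝ => 1 + ε) (𝓝 0) (𝓝 (1 + 0)) :=
      (continuous_const.add continuous_id).tendsto 0
    exact (this.eventually (eventually_ge_nhds (by norm_num : (0 : ℝ) < 1 + 0)))
  filter_upwards [h] with ε hε
  simp only [coord]
  rw [integral_smul_measure, ENNReal.toReal_ofReal hε, smul_eq_mul]

/-- The mass-scaling curve is a deformation curve of `P₀` in the class of all families, `C¹`
along every test class, … [folklore] -/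
theorem isDeformationCurve_massScaling :
    IsDeformationCurve Set.univ 𝒯 P₀ fun ε D => ENNReal.ofReal (1 + ε) • P₀ D := by
  refine ⟨?_, Eventually.of_forall fun _ => Set.mem_univ _, fun D f _ => ?_⟩
  · funext D
    simp
  · have hs : ContDiffAt ℝ 1 (fun ε : ℝ => (1 + ε) * coord P₀ D f) 0 :=
      ((contDiff_const.add contDiff_id).mul contDiff_const).contDiffAt
    exact hs.congr_of_eventuallyEq (coord_massScaling_eventuallyEq P₀ D f)

/-- … and its velocity is the base family itself read as a deformation: `Ṗ_D f = ∫ f d(P₀ D)` on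
test observables. [folklore] -/
theorem velocity_massScaling :
    velocity 𝒯 (fun ε D => ENNReal.ofReal (1 + ε) • P₀ D) = fun D => 𝒯.indicator (coord P₀ D) := by
  funext D f
  by_cases hf : f ∈ 𝒯
  · rw [velocity_apply_of_mem _ D hf, indicator_of_mem hf,
      (coord_massScaling_eventuallyEq P₀ D f).deriv_eq]
    have hd : HasDerivAt (fun ε : ℝ => (1 + ε) * coord P₀ D f) (coord P₀ D f) 0 := by
      simpa using ((hasDerivAt_id (0 : ℝ)).const_add 1).mul_const (coord P₀ D f)
    exact hd.deriv
  · rw [velocity_apply_of_not_mem _ D hf, indicator_of_notMem hf]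

/-- Hence `D ↦ (f ↦ ∫ f d(P₀ D))` (on `𝒯`) is a tangent vector of the class of all families at
`P₀`: tangent cones are not reduced to `{0}` in general. [folklore] -/
theorem indicator_coord_mem_tangentCone_univ :
    (fun D => 𝒯.indicator (coord P₀ D)) ∈ tangentCone Set.univ P₀ 𝒯 :=
  ⟨_, isDeformationCurve_massScaling 𝒯 P₀, velocity_massScaling 𝒯 P₀⟩

end MassScaling

/-! ### Non-vacuity of `TangentAtSLE6` -/

/-- A non-empty tangent cone forces the base family into the class (the curve passes through
`P₀` at `ε = 0`, where it lies in `𝒞`). [folklore] -/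
theorem base_mem_of_mem_tangentCone {𝒞 : Set ChordalFamily} {𝒯 : Set (CurveClass ℂ → ℝ)}
    {P₀ : ChordalFamily} {v : Deformation} (hv : v ∈ tangentCone 𝒞 P₀ 𝒯) : P₀ ∈ 𝒞 := by
  obtain ⟨c, hc, -⟩ := hv
  have h := hc.eventually_mem.self_of_nhds
  rwa [hc.eq_base] at h

/-- **When is `TangentAtSLE6 𝒞` inhabited?** Exactly when `𝒞` contains a family of chordal SLE₆
laws — the non-vacuity clause route items must pair with `H1VanishesAtSLE6 𝒞` (which holds
vacuously for classes missing the SLE₆ family). [folklore] -/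
theorem zero_mem_tangentAtSLE6_iff (𝒞 : Set ChordalFamily) :
    (0 : Deformation) ∈ TangentAtSLE6 𝒞 ↔
      ∃ P₀ : ChordalFamily, (∀ D, IsSLELaw 6 D (P₀ D)) ∧ P₀ ∈ 𝒞 :=
  ⟨fun ⟨P₀, hP, hv⟩ => ⟨P₀, hP, base_mem_of_mem_tangentCone hv⟩,
    fun ⟨P₀, hP, hm⟩ => ⟨P₀, hP, zero_mem_tangentCone hm⟩⟩

/-- Given existence of chordal SLE curves (the named fact `exists_isSLECurve`, hypothesis `hex`),
a family of chordal SLE₆ laws exists, and `0` is a tangent vector at SLE₆ inside every class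
containing it — in particular `TangentAtSLE6 Set.univ` is non-empty. [folklore] -/
theorem zero_mem_tangentAtSLE6 (hex : exists_isSLECurve) {𝒞 : Set ChordalFamily}
    (h𝒞 : ∀ P : ChordalFamily, (∀ D, IsSLELaw 6 D (P D)) → P ∈ 𝒞) :
    (0 : Deformation) ∈ TangentAtSLE6 𝒞 := by
  have h6 : (0 : ℝ≥0) < 6 := by norm_num
  choose Γ hΓ using fun D : DobrushinDomain => hex h6 D
  refine ⟨fun D => Process.preWienerMeasure.map (Γ D), fun D => (hΓ D).isSLELaw_map, ?_⟩
  exact zero_mem_tangentCone (h𝒞 _ fun D => (hΓ D).isSLELaw_map)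

/-! ### Velocities of covariant curves are covariant (the first linearised axiom as a theorem) -/

/-- Push-forward of curve classes along a plane homeomorphism `φ` is a **measurable embedding**
(indeed a measurable self-equivalence of curve space, inverse induced by `φ⁻¹`, functoriality
`CurveClass.map_homeomorph_trans`), given that both push-forwards are Borel (similarities,
conjugation, isometries). [folklore] -/
theorem measurableEmbedding_curveClassMap {φ : ℂ ≃ₜ ℂ}
    (h₁ : Measurable (CurveClass.map (φ : C(ℂ, ℂ))))
    (h₂ : Measurable (CurveClass.map (φ.symm : C(ℂ, ℂ)))) :
    MeasurableEmbedding (CurveClass.map (φ : C(ℂ, ℂ))) := by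
  have hl : Function.LeftInverse (CurveClass.map (φ.symm : C(ℂ, ℂ)))
      (CurveClass.map (φ : C(ℂ, ℂ))) := fun c => by
    change (CurveClass.map (φ.symm : C(ℂ, ℂ)) ∘ CurveClass.map (φ : C(ℂ, ℂ))) c = c
    rw [← CurveClass.map_homeomorph_trans, Homeomorph.self_trans_symm]
    obtain ⟨γ, rfl⟩ := CurveClass.surjective_mk c
    rfl
  have hr : Function.RightInverse (CurveClass.map (φ.symm : C(ℂ, ℂ)))
      (CurveClass.map (φ : C(ℂ, ℂ))) := fun c => by
    change (CurveClass.map (φ : C(ℂ, ℂ)) ∘ CurveClass.map (φ.symm : C(ℂ, ℂ))) c = c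
    rw [← CurveClass.map_homeomorph_trans, Homeomorph.symm_trans_self]
    obtain ⟨γ, rfl⟩ := CurveClass.surjective_mk c
    rfl
  exact (⟨⟨_, _, hl, hr⟩, h₁, h₂⟩ : CurveClass ℂ ≃ᵐ CurveClass ℂ).measurableEmbedding

/-- Change of variables for push-forward along a plane homeomorphism, for ARBITRARY observables
(no measurability of `f` needed: `MeasurableEmbedding.integral_map`). [folklore] -/
theorem integral_map_curveClassMap {φ : ℂ ≃ₜ ℂ} (h₁ : Measurable (CurveClass.map (φ : C(ℂ, ℂ))))
    (h₂ : Measurable (CurveClass.map (φ.symm : C(ℂ, ℂ)))) (μ : Measure (CurveClass ℂ))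
    (f : CurveClass ℂ → ℝ) :
    ∫ γ, f γ ∂(μ.map (CurveClass.map (φ : C(ℂ, ℂ)))) =
      ∫ γ, (f ∘ CurveClass.map (φ : C(ℂ, ℂ))) γ ∂μ :=
  (measurableEmbedding_curveClassMap h₁ h₂).integral_map f

/-- **Velocities of covariant curves are covariant.** If the families `c ε` are covariant under
the plane homeomorphism `φ` for all small `|ε|` (`c ε (φ D) = φ_* (c ε D)`), then the velocity
of `c` along `𝒯` satisfies the linearised covariance `Deformation.IsCovariantUnder 𝒯 · φ`: both
sides are derivatives at `0` of coordinates that agree near `0` by change of variables.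
Werner 2007 §3.2 (1), differentiated. [folklore] -/
theorem velocity_isCovariantUnder {𝒯 : Set (CurveClass ℂ → ℝ)} {c : ℝ → ChordalFamily}
    {φ : ℂ ≃ₜ ℂ} (h₁ : Measurable (CurveClass.map (φ : C(ℂ, ℂ))))
    (h₂ : Measurable (CurveClass.map (φ.symm : C(ℂ, ℂ))))
    (hcov : ∀ᶠ ε in 𝓝 (0 : ℝ), ∀ D : DobrushinDomain,
      c ε (D.map φ) = (c ε D).map (CurveClass.map (φ : C(ℂ, ℂ)))) :
    (velocity 𝒯 c).IsCovariantUnder 𝒯 φ := by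
  intro D f hf hfφ
  rw [velocity_apply_of_mem c _ hf, velocity_apply_of_mem c _ hfφ]
  refine Filter.EventuallyEq.deriv_eq ?_
  filter_upwards [hcov] with ε hε
  rw [coord, coord, hε D, integral_map_curveClassMap h₁ h₂]

/-- Conjugation is an involution of the plane: `conj⁻¹ = conj` as homeomorphisms. [folklore] -/
theorem conjLIE_toHomeomorph_symm :
    (Complex.conjLIE.toHomeomorph : ℂ ≃ₜ ℂ).symm = Complex.conjLIE.toHomeomorph :=
  Homeomorph.ext fun _ => rfl

/-- **Velocities of mirror covariant curves are mirror covariant** (linearised mirror covariance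
as a theorem, for any test class). [folklore] -/
theorem velocity_isMirrorCovariant {𝒯 : Set (CurveClass ℂ → ℝ)} {c : ℝ → ChordalFamily}
    (hcov : ∀ᶠ ε in 𝓝 (0 : ℝ), (c ε).IsMirrorCovariant) :
    (velocity 𝒯 c).IsMirrorCovariant 𝒯 :=
  velocity_isCovariantUnder measurable_curveClassMap_conj
    (by rw [conjLIE_toHomeomorph_symm]; exact measurable_curveClassMap_conj) hcov

/-- Every tangent vector of a class of mirror covariant families (such as
`mirrorLocalMarkovClass`) is mirror covariant to first order. [folklore] -/
theorem isMirrorCovariant_of_mem_tangentCone {𝒞 : Set ChordalFamily}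
    {𝒯 : Set (CurveClass ℂ → ℝ)} {P₀ : ChordalFamily} (h𝒞 : ∀ P ∈ 𝒞, P.IsMirrorCovariant)
    {v : Deformation} (hv : v ∈ tangentCone 𝒞 P₀ 𝒯) : v.IsMirrorCovariant 𝒯 := by
  obtain ⟨c, hc, rfl⟩ := hv
  exact velocity_isMirrorCovariant (hc.eventually_mem.mono fun ε hε => h𝒞 _ hε)

/-- The inverse of a similarity is the similarity `z ↦ c⁻¹ z − c⁻¹ w`. [folklore] -/
theorem similarity_symm (a : ℂ) (ha : a ≠ 0) (w : ℂ) :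
    (similarity a ha w).symm = similarity a⁻¹ (inv_ne_zero ha) (-(a⁻¹ * w)) :=
  Homeomorph.ext fun z => by
    rw [Homeomorph.symm_apply_eq, similarity_apply, similarity_apply]
    field_simp
    ring

/-- **Velocities of similarity covariant curves are similarity covariant** to first order.
[folklore] -/
theorem velocity_isSimilarityCovariant {𝒯 : Set (CurveClass ℂ → ℝ)} {c : ℝ → ChordalFamily}
    (hcov : ∀ᶠ ε in 𝓝 (0 : ℝ), (c ε).IsSimilarityCovariant) :
    (velocity 𝒯 c).IsSimilarityCovariant 𝒯 := by
  intro a ha w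
  refine velocity_isCovariantUnder (measurable_curveClassMap_similarity a ha w) ?_
    (hcov.mono fun ε hε D => hε D a ha w)
  rw [similarity_symm]
  exact measurable_curveClassMap_similarity _ _ _

/-- Every tangent vector of a class of similarity covariant families is similarity covariant to
first order; with `isMirrorCovariant_of_mem_tangentCone` this gives the two linearised covariance
clauses for every `v ∈ TangentAtSLE6 mirrorLocalMarkovClass`. [folklore] -/
theorem isSimilarityCovariant_of_mem_tangentCone {𝒞 : Set ChordalFamily}
    {𝒯 : Set (CurveClass ℂ → ℝ)} {P₀ : ChordalFamily} (h𝒞 : ∀ P ∈ 𝒞, P.IsSimilarityCovariant)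
    {v : Deformation} (hv : v ∈ tangentCone 𝒞 P₀ 𝒯) : v.IsSimilarityCovariant 𝒯 := by
  obtain ⟨c, hc, rfl⟩ := hv
  exact velocity_isSimilarityCovariant (hc.eventually_mem.mono fun ε hε => h𝒞 _ hε)

/-- Three of the linearised axioms hold on `TangentAtSLE6 mirrorLocalMarkovClass` as theorems:
chordality, similarity covariance and mirror covariance to first order. [folklore] -/
theorem linearised_of_mem_tangentAtSLE6 {v : Deformation}
    (hv : v ∈ TangentAtSLE6 mirrorLocalMarkovClass) :
    v.IsChordal smoothExitCylinders ∧ v.IsSimilarityCovariant smoothExitCylinders ∧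
      v.IsMirrorCovariant smoothExitCylinders := by
  obtain ⟨P₀, -, hv⟩ := hv
  exact ⟨isChordal_of_mem_tangentCone (fun P hP => hP.1.isChordal) hv,
    isSimilarityCovariant_of_mem_tangentCone (fun P hP => hP.1.similarity) hv,
    isMirrorCovariant_of_mem_tangentCone (fun P hP => hP.2) hv⟩

end ChordalFamily

end Literature.Probability.RandomPlanarGeometry
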